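import Summits.CriticalPhenomena.CardyFormulaZ2.Theorems.CardyBoundaryCoulombGasBoundaryDefectGaussianRStubTransportPathsPart18
import Summits.CriticalPhenomena.CardyFormulaZ2.Theorems.CardyBoundaryCoulombGasBoundaryDefectGaussianRStubTransportPathsPart23

/-!
# Stub `stub_transportPaths` of line `rainbow-monomials-in-excursion-kernels` — Part 26:
# small bookkeeping for the assembly (separation constants, the processing order, initial points)
# (crux `CardyBoundaryCoulombGas.BoundaryDefectGaussianR`, stmt-CriticalPhenomena-14132)

* `tp_sepG`, `tp_sep_ne` — the separation clause `(r/δ)² ≤ |u-v|²` gives `ℓ∞`-distance `≥ G`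
  when `2 G ≤ r/δ`, and `u ≠ v`;
* `tp_jump_bound` — `2 (u/4 + 4)² ≤ u²` for `u ≥ 64` (the corner jump is within `ρ/δ`);
* `tp_slot_point` — the slot `(X, Y)` is the rail point `X • dir 0 + Y • dir 1` of a bottom edge;
* `tp_pre_lt`, `tp_pre_gt`, `tp_split_notMem_left`, `tp_split_notMem_right` — which points are
  already at their slots when a given mover moves (the processing order is increasing over the
  clockwise movers, then decreasing over the counterclockwise movers);
* `tp_init_point` — the given insertion point near the mark `γ t⋆` of the edge `z` is the rail
  point of along-coordinate `x` with `|δ x - (A + s⋆)| ≤ ε` (Parts 12, 13, 18).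
All [folklore].
-/

noncomputable section

open Set Filter Metric Topology
open Literature.Probability.RandomPlanarGeometry
open Literature.Probability.LatticeModels Literature.Probability.LatticeModels.CollarLegModel
open Summit.CriticalPhenomena.CardyFormulaZ2.Cruxes.RectilinearCardy.ExcursionKernelCovariance

namespace Summit.CriticalPhenomena.CardyFormulaZ2.Cruxes.BoundaryDefectGaussianR.RainbowMonomialsInExcursionKernels

/-! ### Separation constants -/

/-- `(r/δ)² ≤ |u - v|²` and `2 G ≤ r/δ` give `ℓ∞`-distance `≥ G`. [folklore] -/
theorem tp_sepG {r δ : ℝ} {G : ℕ} (hG : 2 * (G : ℝ) ≤ r / δ) (u v : ℤ × ℤ)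
    (h : (r / δ) ^ 2 ≤ (((u.1 - v.1) ^ 2 + (u.2 - v.2) ^ 2 : ℤ) : ℝ)) :
    (G : ℤ) ≤ max |u.1 - v.1| |u.2 - v.2| := by
  by_contra hlt
  push Not at hlt
  have h1 : |u.1 - v.1| < G := lt_of_le_of_lt (le_max_left _ _) hlt
  have h2 : |u.2 - v.2| < G := lt_of_le_of_lt (le_max_right _ _) hlt
  have h1' : (u.1 - v.1) ^ 2 < (G : ℤ) ^ 2 := by
    rw [← sq_abs]; exact pow_lt_pow_left₀ h1 (abs_nonneg _) two_ne_zero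
  have h2' : (u.2 - v.2) ^ 2 < (G : ℤ) ^ 2 := by
    rw [← sq_abs]; exact pow_lt_pow_left₀ h2 (abs_nonneg _) two_ne_zero
  have hsum : (((u.1 - v.1) ^ 2 + (u.2 - v.2) ^ 2 : ℤ) : ℝ) < 2 * (G : ℝ) ^ 2 := by
    have : (u.1 - v.1) ^ 2 + (u.2 - v.2) ^ 2 < 2 * (G : ℤ) ^ 2 := by linarith
    exact_mod_cast this
  have hG0 : (0 : ℝ) ≤ G := Nat.cast_nonneg _
  nlinarith [pow_le_pow_left₀ (by positivity : (0 : ℝ) ≤ 2 * G) hG 2]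

/-- A separated pair is a pair of distinct points. [folklore] -/
theorem tp_sep_ne {r δ : ℝ} (hr : 0 < r / δ) (u v : ℤ × ℤ)
    (h : (r / δ) ^ 2 ≤ (((u.1 - v.1) ^ 2 + (u.2 - v.2) ^ 2 : ℤ) : ℝ)) : u ≠ v := by
  rintro rfl
  have h0 : (((u.1 - u.1) ^ 2 + (u.2 - u.2) ^ 2 : ℤ) : ℝ) = 0 := by push_cast; ring
  rw [h0] at h
  nlinarith

/-- The corner jump is within the jump bound: `2 (u/4 + 4)² ≤ u²` for `u ≥ 64`. [folklore] -/
theorem tp_jump_bound {u : ℝ} (hu : 64 ≤ u) : 2 * (u / 4 + 4) ^ 2 ≤ u ^ 2 := by nlinarith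

/-- The slot `(X, Y)` as a rail point of a bottom edge (`a = 0`). [folklore] -/
theorem tp_slot_point (X Y : ℤ) :
    ((X, Y) : ℤ × ℤ) = X • dir (Fin.ofNat 4 0) + Y • dir (Fin.ofNat 4 0 + 1) := by
  have h0 : (Fin.ofNat 4 0 : Fin 4) = 0 := rfl
  rw [h0, zero_add, tp_dir_val.1, tp_dir_val.2.1]
  ext <;> simp

/-! ### The processing order -/

/-- In an increasing list split at `m`, the prefix consists of the members below `m`.
[folklore] -/
theorem tp_pre_lt {k : ℕ} {l pre post : List (Fin k)} {m : Fin k} (hs : l.Pairwise (· < ·))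
    (h : l = pre ++ m :: post) (i : Fin k) : i ∈ pre ↔ i ∈ l ∧ i < m := by
  subst h
  rw [List.pairwise_append] at hs
  obtain ⟨-, hmp, hcross⟩ := hs
  rw [List.pairwise_cons] at hmp
  constructor
  · intro hi
    exact ⟨List.mem_append_left _ hi, hcross i hi m List.mem_cons_self⟩
  · rintro ⟨hi, hlt⟩
    rcases List.mem_append.1 hi with h | h
    · exact h
    · rcases List.mem_cons.1 h with rfl | h
      · exact absurd hlt (lt_irrefl _)
      · exact absurd (hmp.1 i h) (not_lt.2 hlt.le)

/-- In a decreasing list split at `m`, the prefix consists of the members above `m`.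
[folklore] -/
theorem tp_pre_gt {k : ℕ} {l pre post : List (Fin k)} {m : Fin k} (hs : l.Pairwise (· > ·))
    (h : l = pre ++ m :: post) (i : Fin k) : i ∈ pre ↔ i ∈ l ∧ m < i := by
  subst h
  rw [List.pairwise_append] at hs
  obtain ⟨-, hmp, hcross⟩ := hs
  rw [List.pairwise_cons] at hmp
  constructor
  · intro hi
    exact ⟨List.mem_append_left _ hi, hcross i hi m List.mem_cons_self⟩
  · rintro ⟨hi, hlt⟩
    rcases List.mem_append.1 hi with h | h
    · exact h
    · rcases List.mem_cons.1 h with rfl | h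
      · exact absurd hlt (lt_irrefl _)
      · exact absurd (hmp.1 i h) (not_lt.2 hlt.le)

/-- Splitting `l₁ ++ l₂` at an element not in `l₁`: the prefix contains `l₁`. [folklore] -/
theorem tp_split_notMem_left {α : Type*} {l₁ l₂ pre post : List α} {m : α} (hm : m ∉ l₁)
    (h : l₁ ++ l₂ = pre ++ m :: post) : ∃ pre₂, pre = l₁ ++ pre₂ ∧ l₂ = pre₂ ++ m :: post := by
  rcases List.append_eq_append_iff.1 h with ⟨a', h1, h2⟩ | ⟨c', h1, h2⟩
  · exact ⟨a', h1, h2⟩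
  · cases c' with
    | nil => exact ⟨[], by simpa using h1.symm, by simpa using h2.symm⟩
    | cons x c'' =>
      exfalso
      have hx : m = x := by simpa using (List.cons.inj h2).1
      apply hm
      rw [h1, hx]; simp

/-- Splitting `l₁ ++ l₂` at an element not in `l₂`: the prefix is a prefix of `l₁`. [folklore] -/
theorem tp_split_notMem_right {α : Type*} {l₁ l₂ pre post : List α} {m : α} (hm : m ∉ l₂)
    (h : l₁ ++ l₂ = pre ++ m :: post) : ∃ post₁, l₁ = pre ++ m :: post₁ := by
  rcases List.append_eq_append_iff.1 h with ⟨a', h1, h2⟩ | ⟨c', h1, h2⟩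
  · exfalso; apply hm; rw [h2]; simp
  · cases c' with
    | nil => exfalso; apply hm; rw [← List.nil_append l₂, ← h2]; simp
    | cons x c'' =>
      have hx : m = x := by simpa using (List.cons.inj h2).1
      exact ⟨c'', by rw [h1, hx]⟩

/-! ### The initial insertion points -/

/-- **An initial insertion point is a rail point near its mark.** See the module docstring.
[folklore] -/
theorem tp_init_point (D : JordanDomain) {M : ℕ} {c : ℤ → ℝ} {a τ : ℤ → ℕ}
    (hM2 : 2 ≤ M) (hcmono : StrictMono c) (hcper : ∀ z, c (z + M) = c z + 1)
    (ha4 : ∀ z, a z < 4) (hτ : ∀ z, τ z = 1 ∨ τ z = 3)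
    (hmodτ : ∀ z, (a z + τ z) % 4 = (a (z - 1) + 2) % 4)
    (hdir : ∀ z, ∀ t ∈ Icc (c z) (c (z + 1)), D.boundary t =
      D.boundary (c z) + ((‖D.boundary t - D.boundary (c z)‖ : ℝ) : ℂ) * Complex.I ^ (a z))
    (hmono : ∀ z, StrictMonoOn (fun t => ‖D.boundary t - D.boundary (c z)‖) (Icc (c z) (c (z + 1))))
    (hflatch : ∀ z, ∀ t ∈ Ioo (c z) (c (z + 1)), ∃ r : ℝ, 0 < r ∧ (∀ w, dist w (D.boundary t) < r
      → (w ∈ frontier D.carrier ↔ (((w - D.boundary t) * (-Complex.I) ^ a z).im = 0 ∧ 0 ≤ ((w -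
      D.boundary t) * (-Complex.I) ^ a z).re) ∨ (((w - D.boundary t) * (-Complex.I) ^ (a z +
      2)).im = 0 ∧ 0 ≤ ((w - D.boundary t) * (-Complex.I) ^ (a z + 2)).re))) ∧ (∀ w, dist w
      (D.boundary t) < r → (w ∈ D.carrier ↔ ((2 = 1 → 0 < ((w - D.boundary t) * (-Complex.I) ^ a
      z).re ∧ 0 < ((w - D.boundary t) * (-Complex.I) ^ a z).im) ∧ (2 = 2 → 0 < ((w - D.boundary t)
      * (-Complex.I) ^ a z).im) ∧ (2 = 3 → 0 < ((w - D.boundary t) * (-Complex.I) ^ a z).im ∨ ((w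
      - D.boundary t) * (-Complex.I) ^ a z).re < 0)))) ∧ (∀ w, dist w (D.boundary t) < r → (w ∈
      closure D.carrier ↔ ((2 = 1 → 0 ≤ ((w - D.boundary t) * (-Complex.I) ^ a z).re ∧ 0 ≤ ((w -
      D.boundary t) * (-Complex.I) ^ a z).im) ∧ (2 = 2 → 0 ≤ ((w - D.boundary t) * (-Complex.I) ^
      a z).im) ∧ (2 = 3 → 0 ≤ ((w - D.boundary t) * (-Complex.I) ^ a z).im ∨ ((w - D.boundary t) *
      (-Complex.I) ^ a z).re ≤ 0)))))
    {κ₀ : ℝ} (hκ₀ : ∀ z z' : ℤ, z + 2 ≤ z' → z' ≤ z + M - 2 →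
      ∀ t ∈ Icc (c z) (c (z + 1)), ∀ t' ∈ Icc (c z') (c (z' + 1)),
        κ₀ ≤ dist (D.boundary t) (D.boundary t'))
    {δ : ℝ} (hδ : 0 < δ) {V : Finset (ℤ × ℤ)}
    (hV : ∀ v : ℤ × ℤ, v ∈ V ↔
      ((v.1 : ℂ) * ((δ : ℝ) : ℂ) + (v.2 : ℂ) * ((δ : ℝ) : ℂ) * Complex.I) ∈ closure D.carrier)
    (z : ℤ) {tm : ℝ} (htm : tm ∈ Ioo (c z) (c (z + 1))) {lam ε : ℝ} (hlamκ : lam ≤ κ₀)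
    (hlam1 : lam ≤ ‖D.boundary tm - D.boundary (c z)‖)
    (hlam2 : lam ≤ ‖D.boundary (c (z + 1)) - D.boundary tm‖) (hε : 0 ≤ ε) (hεlam : ε + 3 * δ < lam)
    (u : ℤ × ℤ) (huV : u ∈ V) (hcard : ((neighbours u).filter (fun y => y ∉ V)).card = 1)
    (hdist : dist ((u.1 : ℂ) * ((δ : ℝ) : ℂ) + (u.2 : ℂ) * ((δ : ℝ) : ℂ) * Complex.I)
      (D.boundary tm) ≤ ε) :
    u = (u.1 * (dir (Fin.ofNat 4 (a z))).1 + u.2 * (dir (Fin.ofNat 4 (a z))).2) •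
        dir (Fin.ofNat 4 (a z)) +
      ⌈(D.boundary (c z) * (-Complex.I) ^ (a z)).im / δ⌉ • dir (Fin.ofNat 4 (a z) + 1) ∧
    |δ * (u.1 * (dir (Fin.ofNat 4 (a z))).1 + u.2 * (dir (Fin.ofNat 4 (a z))).2 : ℤ) -
      ((D.boundary (c z) * (-Complex.I) ^ (a z)).re + ‖D.boundary tm - D.boundary (c z)‖)| ≤ ε := by
  set γ := D.boundary with hγ
  set e := a z with he
  set K : Fin 4 := Fin.ofNat 4 e with hK
  have hKe : (K : ℕ) = e := tp_natCast_fin4 (ha4 z)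
  set P := γ (c z) with hP
  set sm := ‖γ tm - P‖ with hsm
  have hlam0 : 0 < lam := by linarith
  have hq : γ tm = P + ((sm : ℝ) : ℂ) * Complex.I ^ e := hdir z tm ⟨htm.1.le, htm.2.le⟩
  have hth := tp_rail_threshold P sm e
  rw [← hq] at hth
  -- the uniform flat chart at the mark
  have hfr := tp_frontier_near_edge D hM2 hcmono hcper ha4 hτ hmodτ hdir hmono hκ₀
    ⟨htm.1.le, htm.2.le⟩ (lam := lam) hlamκ hlam1 hlam2
  obtain ⟨r₀, hr₀, -, hdom, -⟩ := hflatch z tm htm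
  obtain ⟨hclos, -⟩ := tp_edge_chart D (D.boundary_mem_frontier tm) hlam0 hr₀ hfr hdom
  have hclosK : ∀ w, dist w (γ tm) < lam → (w ∈ closure D.carrier ↔
      0 ≤ ((w - γ tm) * (-Complex.I) ^ (K : ℕ)).im) := by rw [hKe]; exact hclos
  -- membership near `u` is the threshold rule
  have hmem : ∀ s t : ℤ, -2 ≤ s → s ≤ 2 → -2 ≤ t → t ≤ 2 →
      (u + s • dir K + t • dir (K + 1) ∈ V ↔
        ⌈(P * (-Complex.I) ^ e).im / δ⌉ ≤ (u + s • dir K + t • dir (K + 1)).1 * (dir (K + 1)).1 +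
          (u + s • dir K + t • dir (K + 1)).2 * (dir (K + 1)).2) := by
    intro s t hs1 hs2 ht1 ht2
    set w := u + s • dir K + t • dir (K + 1) with hw
    have hwd : dist ((w.1 : ℂ) * ((δ : ℝ) : ℂ) + (w.2 : ℂ) * ((δ : ℝ) : ℂ) * Complex.I) (γ tm) < lam := by
      have hsq : (((w.1 - u.1) ^ 2 + (w.2 - u.2) ^ 2 : ℤ) : ℝ) ≤ 3 ^ 2 := by
        have hi : (w.1 - u.1) ^ 2 + (w.2 - u.2) ^ 2 ≤ 9 := by
          rw [hw, (tp_dot_lin K u s t).2.2]; nlinarith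
        exact_mod_cast hi
      have hd := tp_mesh_dist_le hδ.le (by norm_num : (0 : ℝ) ≤ 3) w u hsq
      have := dist_triangle ((w.1 : ℂ) * ((δ : ℝ) : ℂ) + (w.2 : ℂ) * ((δ : ℝ) : ℂ) * Complex.I)
        ((u.1 : ℂ) * ((δ : ℝ) : ℂ) + (u.2 : ℂ) * ((δ : ℝ) : ℂ) * Complex.I) (γ tm)
      linarith
    rw [tp_lattice_flat hδ hV K hclosK w hwd, hKe, hth.1]
  have hrail := tp_on_rail V K u _ hmem huV hcard
  refine ⟨?_, ?_⟩
  · conv_lhs => rw [tp_decomp K u]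
    rw [hrail]
  · have hfr' := (tp_mesh_frame K δ u).1
    rw [hKe] at hfr'
    have hre : |(((u.1 : ℂ) * ((δ : ℝ) : ℂ) + (u.2 : ℂ) * ((δ : ℝ) : ℂ) * Complex.I - γ tm) *
        (-Complex.I) ^ e).re| ≤ ε := by
      refine (Complex.abs_re_le_norm _).trans ?_
      rw [norm_mul, norm_pow, norm_neg, Complex.norm_I, one_pow, mul_one, ← dist_eq_norm]
      exact hdist
    rw [sub_mul, Complex.sub_re, hfr', hth.2] at hre
    exact hre

/-- **Registered sub-goal `s7_sepG` of stub `stub_transportPaths`** (the separation clause gives the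
`ℓ∞` distance `≥ Σ legs`, one-line form of `tp_sepG`). [folklore] -/
theorem s7_sepG : ∀ (r δ : ℝ) (G : ℕ), (2 * (G : ℝ) ≤ r / δ) → ∀ (u v : ℤ × ℤ), ((r / δ) ^ 2 ≤ (((u.1 - v.1) ^ 2 + (u.2 - v.2) ^ 2 : ℤ) : ℝ)) → (G : ℤ) ≤ max |u.1 - v.1| |u.2 - v.2| :=
  fun _ _ _ hG u v h => tp_sepG hG u v h

end Summit.CriticalPhenomena.CardyFormulaZ2.Cruxes.BoundaryDefectGaussianR.RainbowMonomialsInExcursionKernels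

end
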